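import Summits.BirchSwinnertonDyer.BirchSwinnertonDyer.Theorems.KimAtThreeDeepLowerOffStratumLevelLoweringDoubleStabRows
import Literature.NumberTheory.EllipticCurves.LevelLoweringGamma0AtThreeTwoPrimes
import HarnessLib

/-!
# Route `KimAtThreeKolyvagin` (rung W2), crux `DeepLowerAtThreeOffKatoStratum` (item 19679), registered
# stub `stub_nonAdditive`: the SEMISTABLE depth-`1` rows with EXACTLY ONE EXTRA unramified prime `ℓ`, from
# TWELVE NAMED FACTS and the row conditions only (ROAD (b²) CLOSED by name)

Cell `bsd-addord`, seat `bsd-addord-w2-acc2`, gen 5; item `stmt-BirchSwinnertonDyer-19679` (`--supports`, closes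
nothing). ONE application of ★★★★ `…DoubleStabRows.stub_nonAdditive_semistable_twoPrimes_of_exists_levelLoweredNewform`
to the two-prime level-lowering fact `ribet1990_levelLowering_gamma0_newform_at_three_two_primes` (module
`Literature.NumberTheory.EllipticCurves.LevelLoweringGamma0AtThreeTwoPrimes`, BY NAME): its conclusion, with
`a_q(f) = 1` (split `q`) and `a_ℓ(f) = u` substituted, is ★★★★'s hypothesis `hex`.

★★★★′ `stub_nonAdditive_semistable_twoPrimes` — the registered stub's binders VERBATIM (level `M₀·ℓ·q`) +
`Semistable W₀` + «ordinary if good at `3`» + `v₃(∏ c_ℓ) ≤ 1` + `q` split multiplicative, `q ∤ M₀ℓ`, `ℓ ∤ M₀`, `M₀`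
squarefree, `a_ℓ(f) = u = ±1`, `3 ∣ ord_q Δ`, `3 ∣ ord_ℓ Δ`, `3 ∤ ord_p Δ` (`p ∣ M₀` prime, `p ≠ 3`),
`3 ∣ M₀ → 3 ∤ ord_3 Δ` ⟹ the LOWER deep inequality of 19679. Planner row census: 8 107 of the 8 978 (F1)/(F2)-failing
semistable depth-`1` rows (4 197 + 1 867 + 2 043); together with `…RibetRowsAllPrimes` (20 678 rows) this is
28 785 of the 29 656 semistable depth-`1` rows of the stub from named print; the 871 rows with ≥ 2 extra
unramified primes remain. Theorems only; nothing booked; BSD is not proved by any of this.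
-/

set_option autoImplicit false
-- the Theorems namespace of a single-conjunct summit repeats the summit name by design (D-0017)
set_option linter.dupNamespace false

noncomputable section

open scoped MatrixGroups ModularForm Classical NNReal

open CongruenceSubgroup WeierstrassCurve Literature.NumberTheory.EllipticCurves
  Literature.NumberTheory.EllipticCurves.ModularForms

namespace Summit.BirchSwinnertonDyer.BirchSwinnertonDyer.Theorems.KimAtThreeDeepLowerOffStratumLevelLoweringDoubleStabRowsFinal

open Summit.BirchSwinnertonDyer.BirchSwinnertonDyer.Theorems.KimAtThreeDeepLowerOffStratumLevelLoweringVatsalStabRows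
  (lFunction_eq_one_of_hasSplitMultiplicativeReductionAtPrime)
open Summit.BirchSwinnertonDyer.BirchSwinnertonDyer.Theorems.KimAtThreeDeepLowerOffStratumLevelLoweringDoubleStabRows
open Literature.NumberTheory.EllipticCurves.Rank1Residual Literature.NumberTheory.EllipticCurves.Rank1Residual.Typed
  Literature.NumberTheory.EllipticCurves.Skinner2016 Literature.NumberTheory.Automorphic

/-- ★★★★′ **`stub_nonAdditive` (crux 19679 `DeepLowerAtThreeOffKatoStratum`) on its SEMISTABLE depth-`1` rows with
EXACTLY ONE EXTRA prime `ℓ` at which `ρ̄_{E,3}` is unramified (`ℓ ≠ 3`) or finite (`ℓ = 3`), from TWELVE NAMED FACTS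
and the ROW CONDITIONS ONLY.** One application of
`stub_nonAdditive_semistable_twoPrimes_of_exists_levelLoweredNewform` (ROAD (b²): double stabilisation of the
optimal-level newform) to the two-prime level-lowering fact BY NAME.
[cite: DarmonDiamondTaylor1995, Thm. 3.15 and Prop. 2.12] [cite: Diamond1995RefinedSerre, Thm. 6.4 and Cor. 6.5]
[cite: Ribet1990, Thm. 1.1] [cite: ColemanEdixhoven1998, Thm. 2.1] [cite: Vatsal1999, §1 (1.6), Thm. (1.13)]
[cite: GreenbergVatsal2000, §3 (17)–(19)] [cite: Ribet1984ICM, Thm. 4.1] [cite: Skinner2016PacificMC, Thm. C (§1)]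
[cite: Mazur1978, Cor. 4.1] [cite: Kim2022StructureSelmer, Conj. 1.10 (PDF p. 8)] -/
theorem stub_nonAdditive_semistable_twoPrimes
    (hR₂ : ribet1990_levelLowering_gamma0_newform_at_three_two_primes)
    (hCE : colemanEdixhoven1998_heckePolynomial_simpleRoots)
    (hV : vatsal1999_plusSymbol_congruence) (hGV : greenbergVatsal2000_plusSymbol_congruence)
    (hI : ribet1984_iharaLemma)
    (hSk : Skinner2016.thmC_padicValRat_bsd_rank_zero)
    (hmod : hasEntireLFunction_rat) (hGZK : rank_eq_analyticRank_of_analyticRank_le_one)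
    (hM : mazur_not_dvd_maninConstant_of_odd)
    (hBCDT : exists_isNewformOf) (hLL' : diamond1995_refinedSerre) :
    ∀ (W₀ : WeierstrassCurve ℚ) [W₀.IsElliptic] [W₀.IsGloballyMinimal],
      (∀ n : ℕ, W₀.HasSurjectiveModNGaloisRep (3 ^ n : ℕ)) → Finite W₀.sha →
      ∀ {M₀ ℓ q : ℕ} [NeZero M₀] [NeZero ℓ] [Fact ℓ.Prime] [NeZero q] [Fact q.Prime] [NeZero (M₀ * ℓ)]
        [NeZero (M₀ * ℓ * q)], M₀ * ℓ * q = W₀.conductorNorm ℤ →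
      ∀ (D₀ : ModularParametrizationData W₀ (M₀ * ℓ * q)),
        (∀ z ∈ D₀.L.lattice, ∃ w ∈ periodLattice D₀.f, z = D₀.c * w) →
        (∀ (W₂ : WeierstrassCurve ℚ) [W₂.IsElliptic] (D₂ : ModularParametrizationData W₂ (M₀ * ℓ * q)),
          D₂.f = D₀.f → D₀.modularDegree ≤ D₂.modularDegree) →
        (∀ r : ℚ, ratPlusSymbol D₀.f r ≠ 0 → 0 ≤ padicValRat 3 (ratPlusSymbol D₀.f r)) →
        kuriharaVanishingOrder W₀ 3 D₀.f = 0 →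
        ¬ (haveI : Fact (Nat.Prime 3) := ⟨Nat.prime_three⟩; Addv W₀ 3) →
        Semistable W₀ →
        (W₀.HasGoodReductionAtPrime 3 → ¬ (3 : ℤ) ∣ W₀.frobeniusTrace 3) →
        padicValNat 3 W₀.tamagawaProduct ≤ 1 →
        W₀.HasSplitMultiplicativeReductionAtPrime q → ¬ q ∣ M₀ * ℓ → ¬ ℓ ∣ M₀ → Squarefree M₀ →
        ∀ {u : ℤ}, u * u = 1 → cuspCoeff D₀.f ℓ = u →
        (3 : ℤ) ∣ padicValRat q W₀.Δ → (3 : ℤ) ∣ padicValRat ℓ W₀.Δ →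
        (∀ p : ℕ, p.Prime → p ∣ M₀ → p ≠ 3 → ¬ (3 : ℤ) ∣ padicValRat p W₀.Δ) →
        (3 ∣ M₀ → ¬ (3 : ℤ) ∣ padicValRat 3 W₀.Δ) →
        ∃ d : ℕ, kuriharaPartialDeepInfty W₀ 3 D₀.f = d ∧
          kuriharaPartial W₀ 3 D₀.f 0 ≤
            ((padicValNat 3 (Nat.card (AddCommGroup.primaryComponent W₀.sha 3)) + d : ℕ) : ℕ∞) := by
  intro W₀ _ _ htower hfin M₀ ℓ q _ _ _ _ _ _ _ hN D₀ hopt hdeg hint hord hnA hsst hordinary hv hsplit hqM hℓM hM₀sq u hu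
    hfℓ hqΔ hℓΔ hpΔ h3Δ
  have hℓ : ℓ.Prime := Fact.out
  have hsurj : W₀.HasSurjectiveModNGaloisRep 3 := by simpa using htower 1
  have hMsq : Squarefree (M₀ * ℓ) :=
    (Nat.squarefree_mul ((Nat.Prime.coprime_iff_not_dvd hℓ).mpr hℓM).symm).mpr ⟨hM₀sq, hℓ.prime.squarefree⟩
  have hfq : cuspCoeff D₀.f q = 1 := by
    rw [D₀.isNewformOf.2 q, lFunction_eq_one_of_hasSplitMultiplicativeReductionAtPrime W₀ q hsplit, Int.cast_one]
  refine stub_nonAdditive_semistable_twoPrimes_of_exists_levelLoweredNewform hCE hV hGV hI hSk hmod hGZK hM hBCDT hLL'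
    W₀ htower hfin hN D₀ hopt hdeg hint hord hnA hsst hordinary hv hsplit hqM hℓM hMsq hu hfℓ fun ι ↦ ?_
  obtain ⟨g, hg, hcp, haq, haℓ⟩ := hR₂ W₀ hsurj hℓM hqM hM₀sq hN hqΔ hℓΔ hpΔ h3Δ D₀ ι
  rw [hfq, one_mul] at haq
  rw [hfℓ] at haℓ
  exact ⟨g, hg, hcp, haq, haℓ⟩

end Summit.BirchSwinnertonDyer.BirchSwinnertonDyer.Theorems.KimAtThreeDeepLowerOffStratumLevelLoweringDoubleStabRowsFinal

end
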